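import Summits.BirchSwinnertonDyer.Rank1Residual.Additive.StrictSignedSelmerDual
import Summits.BirchSwinnertonDyer.Rank1Residual.Additive.QuadraticBranchOddStrictSelmer
import Literature.NumberTheory.EllipticCurves.SubgroupSelmerProofs
import Literature.NumberTheory.EllipticCurves.H1UnramifiedFinite
import HarnessLib

/-!
# The bottom layer of Kobayashi's strict-minus structure IS the `p`-strict Selmer group:
# `#Sel^{−,str}(E/K_0) = #(Sel_{p^∞}(E/K) ∩ ker res_p)`, hence `ord_p #Sel_str(W/ℚ)[p^∞] ≤ ord_p f(0)`
# (cell `b2b-bsdres`, team n1011, r = 1 strand, seat p17 GEN 3; row T-O7ss-P13 FILE 3 — sequel of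
# `StrictSignedSelmer.lean` / `StrictSignedSelmerDual.lean`; meets cc-typer-6's p259634 at its abbrev
# `strictSelmerPInfty W p`)

HONEST FRAMING (cell `b2b-bsdres`, run/shared/lean/b2b/bsd-rank1-residual/, verbatim in every
file): the goal of the cell is to DELETE the COMBINATION-SHAPED residual classes of the
Birch–Swinnerton-Dyer formula for ALL analytic-rank `≤ 1` elliptic curves over `ℚ` — "full BSD
formula for every rank `≤ 1` curve in class `C`" assembled STRICTLY from published theorems — so
that the rank-`≤ 1` remainder becomes exactly the CONSTRUCTION-SHAPED classes, which are TYPED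
(missing-input `Prop`s), NOT attempted. This is not "finishing BSD". Team n1011: prove what is
provable now; shrink each hard class to its core with data; no claim beyond stated classes; research
routes; census output = EVIDENCE / conjecture items, never a Literature fact; RESIDUAL-MAP marks
change only by signed lines. O7-ss stays OPEN, X4 CONSTRUCTION-SHAPED; nothing here is booked; no
label moves. Theorems only (NO definition, NO Literature fact, NO `_holds` of a conjecture);
`#print axioms` standard.

## What

Kobayashi, Invent. Math. 152 (2003), §2 p. 4: on `η ≠ 1` the `m = −1` clause "`Tr_{n/0} P ∈
Ê(K_{−1,v})`, `K_{−1} = ℚ`" kills the local condition at `p` at the bottom layer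
(`Ê(K_{0,v})^η ∩ Ê(ℚ_p) = 0`): `Sel⁻(V/K_0)^η` is the `p`-STRICT Selmer group (cc-typer-6's
dictionary, p259634). In `W`-coordinates (FILE 2a) the bottom strict-minus local group is the
TORSION of `E(E)`, and this file proves that the Kummer condition cut out by torsion points is
LOCAL TRIVIALITY in `H¹(E, E[p^∞])`:
* §1 (algebra) `exists_primary_shadow_of_isOfFinAddOrder`: a torsion `Q` has a `p`-primary multiple
  `R` with `f R − R = f Q − Q` for every additive `f` with `f Q − Q` `p`-primary (Bezout).
* §2 (cocycles) `resH1Hom_subgroupIncl_mem_localKummerOverOfEmb_iff`: for `H ≤ Γ_K` containing every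
  element and `A` ≤ torsion, `res c` satisfies Kobayashi's Kummer condition for `A`
  (`localKummerOverOfEmb`) iff `c` dies in `H¹(E, E(K̄_E)[p^∞])` (`selmerLocalKerPrimaryTorsion W E p`,
  the tree's `p`-strict local kernel; Skinner 2020 §2.2) — `oneCocycleClass_eq_zero_iff` /
  `oneCocycleClass_mem_resKer_iff` and §1.
* §3 `natCard_strictSignedSelmerLayer_neg_one_zero_eq`: along the bijective `res : H¹(Γ_K, ·) →
  H¹(κ⁻¹(p⁰ℤ_p) = ⊤, ·)` (`bijective_resH1Hom_subgroupIncl`, `…_mem_selmerGroupOver_top_iff`):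
  **`#Sel^{−,str}(E/K_0) = #(Sel_{p^∞}(E/K) ⊓ selmerLocalKerPrimaryTorsion W E p)`** (any `K`, `κ`,
  `E`); for `K = ℚ`, `E = ℚ_[p]` the right side is cc-typer-6's `strictSelmerPInfty W p`.
* §4 (`StrictSignedControlZero.finite_and_padicValNat_card_strictSelmerPInfty_le`): for `W/ℚ`, `κ`
  with topological generator `γ`, a strict-minus dual datum `D : StrictSignedSelmerDualData W κ ℚ_[p]
  γ (-1)` with `X` f.g. torsion, `char = (f)`, `f(0) ≠ 0`, no finite `Λ`-submodule, `E(ℚ_∞)[p^∞] = 0`: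
  **`Sel_str(W/ℚ)[p^∞]` is finite and `ord_p #Sel_str(W/ℚ)[p^∞] ≤ ord_p f(0)`** — with the readings
  (R1)/(R2) of FILE 4a this is `QuadraticBranchOddStrictSelmerBoundAt W p` (FILE 4b).

References: [Kobayashi2003] §2 p. 4, Def. 2.1, Lemma 9.1; [GreenbergLNM1716] §2, §4 Lemma 4.2;
[Skinner2020] §2.2; [Kim2022] §1.
-/

noncomputable section

open scoped Classical

universe u

namespace Summit.BirchSwinnertonDyer.Rank1Residual.Additive

open WeierstrassCurve Literature.NumberTheory Literature.NumberTheory.EllipticCurves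
  Literature.NumberTheory.EllipticCurves.IwasawaAlgebra Literature.NumberTheory.EllipticCurves.IwasawaDual
  Literature.NumberTheory.EllipticCurves.Kobayashi2003 ZpExtension

namespace StrictSignedLayerZero

/-! ## §1 Algebra: the `p`-primary shadow of a torsion element -/

section Algebra

variable {M : Type*} [AddCommGroup M] (p : ℕ) [hp : Fact p.Prime]

/-- A `p`-primary element killed by an integer prime to `p` is zero. [folklore] -/
theorem eq_zero_of_mem_primaryComponent_of_nsmul_eq_zero {x : M} {n : ℕ}
    (hx : x ∈ AddCommGroup.primaryComponent M p) (hn : ¬ p ∣ n) (hnx : n • x = 0) : x = 0 := by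
  obtain ⟨k, hk⟩ := (AddCommGroup.mem_primaryComponent (G := M) (p := p)).mp hx
  have hcop : Nat.Coprime (p ^ k) n :=
    Nat.Coprime.pow_left k ((Nat.Prime.coprime_iff_not_dvd hp.out).mpr hn)
  have h1 : addOrderOf x ∣ p ^ k := addOrderOf_dvd_of_nsmul_eq_zero hk
  have h2 : addOrderOf x ∣ n := addOrderOf_dvd_of_nsmul_eq_zero hnx
  have h3 : addOrderOf x ∣ Nat.gcd (p ^ k) n := Nat.dvd_gcd h1 h2
  rw [hcop.gcd_eq_one, Nat.dvd_one] at h3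
  exact AddMonoid.addOrderOf_eq_one_iff.mp h3

/-- **The `p`-primary shadow of a torsion element.** If `Q` has finite order, there is a
`p`-PRIMARY element `R` (an integer multiple of `Q`) such that `f R − R = f Q − Q` for every additive
endomorphism `f` with `f Q − Q` `p`-primary. Proof: `ord Q = pᵃ·n`, `p ∤ n`, Bezout
`1 = pᵃ u + n v`; `R := (n v)•Q`; then `Q − R = (pᵃ u)•Q` is killed by `n`, so `f(Q − R) − (Q − R)` is
`p`-primary and killed by `n`, hence `0`. [folklore] -/
theorem exists_primary_shadow_of_isOfFinAddOrder {Q : M} (hQ : IsOfFinAddOrder Q) :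
    ∃ R : M, R ∈ AddCommGroup.primaryComponent M p ∧
      ∀ f : M →+ M, f Q - Q ∈ AddCommGroup.primaryComponent M p → f R - R = f Q - Q := by
  have hN : addOrderOf Q ≠ 0 := (IsOfFinAddOrder.addOrderOf_pos hQ).ne'
  obtain ⟨a, n, hn, hN'⟩ := Nat.exists_eq_pow_mul_and_not_dvd hN p hp.out.ne_one
  have hcop : Nat.Coprime (p ^ a) n :=
    Nat.Coprime.pow_left a ((Nat.Prime.coprime_iff_not_dvd hp.out).mpr hn)
  -- Bezout: `p^a * u + n * v = 1` over `ℤ`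
  set u : ℤ := Nat.gcdA (p ^ a) n with hu
  set v : ℤ := Nat.gcdB (p ^ a) n with hv
  have hbez : ((p ^ a : ℕ) : ℤ) * u + (n : ℤ) * v = 1 := by
    have h := Nat.gcd_eq_gcd_ab (p ^ a) n
    rw [hcop.gcd_eq_one] at h
    exact_mod_cast h.symm
  have hNQ : (addOrderOf Q) • Q = 0 := addOrderOf_nsmul_eq_zero Q
  -- `p^a • R = v • (N • Q) = 0`
  have hR : ((n : ℤ) * v) • Q ∈ AddCommGroup.primaryComponent M p := by
    refine (AddCommGroup.mem_primaryComponent (G := M) (p := p)).mpr ⟨a, ?_⟩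
    rw [← natCast_zsmul, smul_smul]
    have : ((p ^ a : ℕ) : ℤ) * ((n : ℤ) * v) = v * (addOrderOf Q : ℕ) := by
      rw [hN']; push_cast; ring
    rw [this, ← smul_smul, natCast_zsmul, hNQ, smul_zero]
  refine ⟨((n : ℤ) * v) • Q, hR, fun f hf ↦ ?_⟩
  · -- `Q - R = (p^a u) • Q`, killed by `n`
    set C : M := Q - ((n : ℤ) * v) • Q with hC
    have hCeq : C = (((p ^ a : ℕ) : ℤ) * u) • Q := by
      have h1 : ((p ^ a : ℕ) : ℤ) * u = 1 - (n : ℤ) * v := by linarith [hbez]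
      rw [hC, h1, sub_smul, one_smul]
    have hnC : n • C = 0 := by
      rw [hCeq, ← natCast_zsmul, smul_smul]
      have : (n : ℤ) * (((p ^ a : ℕ) : ℤ) * u) = u * (addOrderOf Q : ℕ) := by
        rw [hN']; push_cast; ring
      rw [this, ← smul_smul, natCast_zsmul, hNQ, smul_zero]
    -- `f C - C` is `p`-primary and killed by `n`
    have hfR : f (((n : ℤ) * v) • Q) - ((n : ℤ) * v) • Q ∈ AddCommGroup.primaryComponent M p := by
      refine sub_mem ?_ hR
      obtain ⟨k, hk⟩ := (AddCommGroup.mem_primaryComponent (G := M) (p := p)).mp hR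
      exact (AddCommGroup.mem_primaryComponent (G := M) (p := p)).mpr
        ⟨k, by rw [← map_nsmul, hk, map_zero]⟩
    have hdiff : f C - C = (f Q - Q) - (f (((n : ℤ) * v) • Q) - ((n : ℤ) * v) • Q) := by
      rw [hC, map_sub]; abel
    have hprim : f C - C ∈ AddCommGroup.primaryComponent M p := by
      rw [hdiff]; exact sub_mem hf hfR
    have hkill : n • (f C - C) = 0 := by
      rw [smul_sub, ← map_nsmul, hnC, map_zero, sub_zero]
    have hzero : f C - C = 0 :=
      eq_zero_of_mem_primaryComponent_of_nsmul_eq_zero p hprim hn hkill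
    rw [hdiff, sub_eq_zero] at hzero
    exact hzero.symm

end Algebra

/-! ## §2 The Kummer condition cut out by torsion points is local triviality in `H¹(E, E[p^∞])` -/

section Local

variable {K : Type u} [Field K] (W : WeierstrassCurve K) (p : ℕ) [Fact p.Prime]
  {E : Type u} [Field E] [Algebra K E]

omit [Fact p.Prime] in
/-- On cocycles: the restriction `res : H¹(Γ_K, E[p^∞]) → H¹(H, E[p^∞])` along the inclusion of a
subgroup sends `[ψ]` to the class of `ψ|_H` (`map_oneCocycleClass`). [folklore] -/
theorem resH1Hom_subgroupIncl_oneCocycleClass (H : Subgroup (Field.absoluteGaloisGroup K))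
    (ψ : GaloisRepresentations.contOneCocycles
      (discreteTopRep (Field.absoluteGaloisGroup K) (W.geomPrimaryTorsion p))) :
    resH1Hom (subgroupIncl H) (AddMonoidHom.id (W.geomPrimaryTorsion p)) (fun _ _ ↦ rfl)
        (GaloisRepresentations.oneCocycleClass _ ψ) =
      GaloisRepresentations.oneCocycleClass (discreteTopRep H (W.geomPrimaryTorsion p))
        (GaloisRepresentations.contOneCocycles.pullback (subgroupIncl H)
          (resHomOfEquivariant (subgroupIncl H) (AddMonoidHom.id (W.geomPrimaryTorsion p))
            (fun _ _ ↦ rfl)) ψ) := by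
  change (ContinuousCohomology.map (subgroupIncl H)
    (resHomOfEquivariant (subgroupIncl H) (AddMonoidHom.id (W.geomPrimaryTorsion p)) (fun _ _ ↦ rfl))
      1).hom (GaloisRepresentations.oneCocycleClass _ ψ) = _
  exact GaloisRepresentations.map_oneCocycleClass _ _ _ ψ

/-- **The Kummer condition cut out by TORSION points is the `p`-strict local condition.** Let
`H ≤ Γ_K` contain every element (`κ⁻¹(p⁰ℤ_p)` at the bottom layer) and let `A` be a subgroup of
torsion points of `E(K̄_E)`. For `c ∈ H¹(K, E[p^∞])`: `res c` lies in Kobayashi's Kummer condition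
`localKummerOverOfEmb W p H (closureEmb E) A` ("`res_w c = κ_w(a ⊗ p⁻ᵏ)`, `a ∈ A`", on cocycles:
`ι(φ(τ)) = τQ − Q` with `pᵏQ ∈ A`) iff `c` dies in `H¹(E, E(K̄_E)[p^∞])`
(`selmerLocalKerPrimaryTorsion W E p`). (→): `Q` is torsion, and its `p`-primary shadow `R` (§1)
satisfies `τR − R = τQ − Q` because each `τQ − Q = ι(φ(τ))` is `p`-primary; (←): a coboundary
witness `R ∈ E(K̄_E)[p^∞]` is a Kummer witness with `pᵏR = 0 ∈ A`. This is the `η ≠ 1` content of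
Kobayashi's `m = −1` clause: `A ⊗ ℚ_p/ℤ_p = 0`. [cite: Kobayashi2003, §2 p. 4 (m = −1, K_{−1} = ℚ)]
[cite: GreenbergLNM1716, §2 (pp. 62–63, Kummer theory)] -/
theorem resH1Hom_subgroupIncl_mem_localKummerOverOfEmb_iff (H : Subgroup (Field.absoluteGaloisGroup K))
    (hH : ∀ g, g ∈ H) (A : AddSubgroup (localPoints W E)) (hA : ∀ Q ∈ A, IsOfFinAddOrder Q)
    (c : W.galH1Primary p) :
    resH1Hom (subgroupIncl H) (AddMonoidHom.id (W.geomPrimaryTorsion p)) (fun _ _ ↦ rfl) c ∈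
        localKummerOverOfEmb W p H (closureEmb (K := K) E) A ↔
      c ∈ selmerLocalKerPrimaryTorsion W E p := by
  obtain ⟨ψ, rfl⟩ := GaloisRepresentations.oneCocycleClass_surjective _ c
  -- the restricted cocycle `φ₀ = ψ|_H` and its values
  set φ₀ := GaloisRepresentations.contOneCocycles.pullback (subgroupIncl H)
    (resHomOfEquivariant (subgroupIncl H) (AddMonoidHom.id (W.geomPrimaryTorsion p)) (fun _ _ ↦ rfl)) ψ
    with hφ₀
  have hφ₀_apply : ∀ g : H, φ₀.1 g = ψ.1 (g : Field.absoluteGaloisGroup K) := fun g ↦ rfl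
  rw [resH1Hom_subgroupIncl_oneCocycleClass, ← hφ₀]
  -- the strict local kernel on cocycles
  have hker : GaloisRepresentations.oneCocycleClass _ ψ ∈ selmerLocalKerPrimaryTorsion W E p ↔
      ∃ a : AddCommGroup.primaryComponent (localPoints W E) p,
        ∀ x : Field.absoluteGaloisGroup E,
          primaryPointsMap W E p (ψ.1 (resGal (K := K) E x)) = x • a - a := by
    unfold selmerLocalKerPrimaryTorsion
    exact oneCocycleClass_mem_resKer_iff _ _ _ ψ
  rw [hker, mem_localKummerOverOfEmb_iff]
  constructor
  · rintro ⟨φ, Q, k, hφc, hQA, hτ⟩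
    -- `φ` and `φ₀` differ by a coboundary `g ↦ g•m − m`
    have hcob : GaloisRepresentations.oneCocycleClass _ (φ - φ₀) = 0 := by
      rw [GaloisRepresentations.oneCocycleClass_sub, hφc, sub_self]
    obtain ⟨m, hm⟩ := (GaloisRepresentations.oneCocycleClass_eq_zero_iff _ _).mp hcob
    -- `Q' := Q − ι m` is torsion and `ι(ψ(τ)) = τ Q' − Q'`
    set Q' : localPoints W E := Q - pointsMap W E (m : W.geomPoints) with hQ'
    have hQ'tors : IsOfFinAddOrder Q' := by
      have hQt : Q ∈ AddCommGroup.torsion (localPoints W E) := by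
        rw [AddCommGroup.mem_torsion]
        obtain ⟨N, hNpos, hN⟩ := (isOfFinAddOrder_iff_nsmul_eq_zero).mp (hA _ hQA)
        exact (isOfFinAddOrder_iff_nsmul_eq_zero).mpr
          ⟨N * p ^ k, Nat.mul_pos hNpos (pow_pos (Nat.Prime.pos Fact.out) k),
            by rw [mul_smul, hN]⟩
      have hmt : pointsMap W E (m : W.geomPoints) ∈ AddCommGroup.torsion (localPoints W E) := by
        rw [AddCommGroup.mem_torsion]
        obtain ⟨j, hj⟩ := (AddCommGroup.mem_primaryComponent (G := W.geomPoints) (p := p)).mp m.2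
        exact (isOfFinAddOrder_iff_nsmul_eq_zero).mpr
          ⟨p ^ j, pow_pos (Nat.Prime.pos Fact.out) j, by rw [← map_nsmul, hj, map_zero]⟩
      rw [← AddCommGroup.mem_torsion]
      exact sub_mem hQt hmt
    have hψτ : ∀ τ : Field.absoluteGaloisGroup E,
        pointsMap W E ((ψ.1 (resGal (K := K) E τ) : W.geomPrimaryTorsion p) : W.geomPoints) =
          τ • Q' - Q' := by
      intro τ
      have hτ' := hτ ⟨τ, hH _⟩
      have hg : (resGalSubgroupOfEmb H (closureEmb (K := K) E) ⟨τ, hH _⟩ : H) =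
          ⟨resGal (K := K) E τ, hH _⟩ := Subtype.ext rfl
      have hφval : (φ.1 (resGalSubgroupOfEmb H (closureEmb (K := K) E) ⟨τ, hH _⟩) :
          W.geomPrimaryTorsion p) =
          ψ.1 (resGal (K := K) E τ) + ((resGal (K := K) E τ) • m - m) := by
        have h := hm (resGalSubgroupOfEmb H (closureEmb (K := K) E) ⟨τ, hH _⟩)
        rw [hg] at h ⊢
        have h' : (φ - φ₀).1 ⟨resGal (K := K) E τ, hH _⟩ =
            φ.1 ⟨resGal (K := K) E τ, hH _⟩ - ψ.1 (resGal (K := K) E τ) := rfl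
        rw [h'] at h
        rw [sub_eq_iff_eq_add'] at h
        rw [h, discreteTopRep_ρ_apply, Subgroup.smul_def]
      rw [hφval] at hτ'
      change pointsMap W E _ = _ at hτ'
      rw [AddSubgroup.coe_add, map_add, AddSubgroup.coe_sub,
        Literature.NumberTheory.EllipticCurves.primaryComponent.coe_smul, map_sub, pointsMap_smul]
        at hτ'
      rw [hQ', smul_sub]
      have := hτ'
      calc pointsMap W E ((ψ.1 (resGal (K := K) E τ) : W.geomPrimaryTorsion p) : W.geomPoints)
          = (τ • Q - Q) - (τ • pointsMap W E (m : W.geomPoints) - pointsMap W E (m : W.geomPoints)) :=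
            by rw [← this]; abel
        _ = τ • Q - τ • pointsMap W E (m : W.geomPoints) - (Q - pointsMap W E (m : W.geomPoints)) :=
            by abel
    obtain ⟨R, hR, hRf⟩ := exists_primary_shadow_of_isOfFinAddOrder p hQ'tors
    refine ⟨⟨R, hR⟩, fun τ ↦ Subtype.ext ?_⟩
    have hprim : (DistribSMul.toAddMonoidHom (localPoints W E) τ) Q' - Q' ∈
        AddCommGroup.primaryComponent (localPoints W E) p := by
      rw [DistribSMul.toAddMonoidHom_apply, ← hψτ τ]
      exact (primaryPointsMap W E p (ψ.1 (resGal (K := K) E τ))).2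
    have h := hRf (DistribSMul.toAddMonoidHom (localPoints W E) τ) hprim
    rw [DistribSMul.toAddMonoidHom_apply, DistribSMul.toAddMonoidHom_apply, ← hψτ τ] at h
    rw [AddSubgroup.coe_sub, Literature.NumberTheory.EllipticCurves.primaryComponent.coe_smul]
    exact h.symm
  · rintro ⟨a, ha⟩
    obtain ⟨k, hk⟩ := (AddCommGroup.mem_primaryComponent (G := localPoints W E) (p := p)).mp a.2
    refine ⟨φ₀, (a : localPoints W E), k, rfl, by rw [hk]; exact zero_mem A, fun τ ↦ ?_⟩
    have hg : (resGalSubgroupOfEmb H (closureEmb (K := K) E) τ : H) =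
        ⟨resGal (K := K) E τ, hH _⟩ := Subtype.ext rfl
    rw [hg, hφ₀_apply]
    have h := congrArg (fun z : AddCommGroup.primaryComponent (localPoints W E) p ↦
      (z : localPoints W E)) (ha (τ : Field.absoluteGaloisGroup E))
    simp only [AddSubgroup.coe_sub, Literature.NumberTheory.EllipticCurves.primaryComponent.coe_smul]
      at h
    exact h

end Local

/-! ## §3 `#Sel^{−,str}(E/K_0) = #(Sel_{p^∞}(E/K) ∩ ker res_E)` -/

section LayerZero

variable {K : Type u} [Field K] [NumberField K] (W : WeierstrassCurve K) (p : ℕ) [Fact p.Prime]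
  (E : Type u) [Field E] [Algebra K E]

/-- **Selmer group plus a torsion Kummer condition over `H = ⊤`, counted in `H¹(K, E[p^∞])`.** For
`A` a subgroup of torsion points of `E(K̄_E)`, the subgroup of `H¹(⊤, E[p^∞])` cut out by the Selmer
conditions (`selmerGroupOver p ⊤`) and Kobayashi's Kummer condition for `A` at `closureEmb E` and all
its `Γ_K`-conjugates has the cardinality of `Sel_{p^∞}(E/K) ⊓ selmerLocalKerPrimaryTorsion W E p`:
transport along the bijective `res` (`bijective_resH1Hom_subgroupIncl`), the Selmer part by
`resH1Hom_subgroupIncl_mem_selmerGroupOver_top_iff`, the Kummer part by §2, conjugations being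
trivial on `H¹(⊤, ·)` (`conjH1_of_mem_holds`). [cite: GreenbergLNM1716, §2]
[cite: Kobayashi2003, §2 p. 4] -/
theorem natCard_selmerGroupOver_inf_localKummer_eq (H : Subgroup (Field.absoluteGaloisGroup K))
    [H.Normal] (hH : H = ⊤) (A : AddSubgroup (localPoints W E)) (hA : ∀ Q ∈ A, IsOfFinAddOrder Q) :
    Nat.card ↥(W.selmerGroupOver p H ⊓
        ⨅ σ : Field.absoluteGaloisGroup K,
          (localKummerOverOfEmb W p H (closureEmb (K := K) E) A).comap (W.conjH1 p H σ)) =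
      Nat.card ↥(W.selmerGroupPInfty p ⊓ selmerLocalKerPrimaryTorsion W E p) := by
  subst hH
  set res := resH1Hom (subgroupIncl (⊤ : Subgroup (Field.absoluteGaloisGroup K)))
    (AddMonoidHom.id (W.geomPrimaryTorsion p)) (fun _ _ ↦ rfl) with hres
  have hbij : Function.Bijective res := bijective_resH1Hom_subgroupIncl _ ⊤ Subgroup.mem_top
  let e : W.galH1Primary p ≃+ W.subgroupH1 p (⊤ : Subgroup (Field.absoluteGaloisGroup K)) :=
    AddEquiv.ofBijective res hbij
  have hconj : ∀ (σ : Field.absoluteGaloisGroup K) (c : W.galH1Primary p),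
      W.conjH1 p ⊤ σ (res c) = res c := fun σ c ↦ by
    rw [W.conjH1_of_mem_holds p ⊤ (Subgroup.mem_top σ), AddMonoidHom.id_apply]
  have hmem : ∀ c : W.galH1Primary p,
      res c ∈ (W.selmerGroupOver p ⊤ ⊓ ⨅ σ : Field.absoluteGaloisGroup K,
          (localKummerOverOfEmb W p ⊤ (closureEmb (K := K) E) A).comap (W.conjH1 p ⊤ σ)) ↔
        c ∈ W.selmerGroupPInfty p ⊓ selmerLocalKerPrimaryTorsion W E p := fun c ↦ by
    rw [AddSubgroup.mem_inf, AddSubgroup.mem_inf, AddSubgroup.mem_iInf,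
      W.resH1Hom_subgroupIncl_mem_selmerGroupOver_top_iff p c]
    simp only [AddSubgroup.mem_comap, hconj, forall_const]
    rw [resH1Hom_subgroupIncl_mem_localKummerOverOfEmb_iff W p ⊤ Subgroup.mem_top A hA c]
  have hmap : (W.selmerGroupPInfty p ⊓ selmerLocalKerPrimaryTorsion W E p).map
      (e : W.galH1Primary p →+ W.subgroupH1 p ⊤) =
      W.selmerGroupOver p ⊤ ⊓ ⨅ σ : Field.absoluteGaloisGroup K,
        (localKummerOverOfEmb W p ⊤ (closureEmb (K := K) E) A).comap (W.conjH1 p ⊤ σ) := by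
    ext d
    constructor
    · rintro ⟨c, hc, rfl⟩
      exact (hmem c).mpr hc
    · intro hd
      obtain ⟨c, rfl⟩ := hbij.2 d
      exact ⟨c, (hmem c).mp hd, rfl⟩
  exact (Nat.card_congr ((e.addSubgroupMap _).trans (AddEquiv.addSubgroupCongr hmap)).toEquiv).symm

variable {p} (κ : ZpExtension K p)

/-- **The bottom layer of the strict-minus structure is the `p`-strict Selmer group**:
`#Sel^{−,str}(E/K_0) = #(Sel_{p^∞}(E/K) ⊓ selmerLocalKerPrimaryTorsion W E p)` — the bottom strict
minus local group is the torsion of `E(E)` (`mem_strictSignedLocalPointsOfEmb_neg_one_zero_iff`),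
`κ⁻¹(p⁰ℤ_p) = ⊤` (`layerSubgroup_zero`), `Sel_{p^∞}(E/K_0) = selmerGroupOver` (definitional), and
`natCard_selmerGroupOver_inf_localKummer_eq`. [cite: Kobayashi2003, §2 p. 4 (m = −1) and Def. 2.1]
[cite: Skinner2020, §2.2] -/
theorem natCard_strictSignedSelmerLayer_neg_one_zero_eq :
    Nat.card ↥(strictSignedSelmerLayer W κ E (-1) 0) =
      Nat.card ↥(W.selmerGroupPInfty p ⊓ selmerLocalKerPrimaryTorsion W E p) :=
  natCard_selmerGroupOver_inf_localKummer_eq W p E (κ.layerSubgroup 0) κ.layerSubgroup_zero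
    (strictSignedLocalPoints κ E W (-1) 0) fun Q hQ ↦ by
      rw [← AddCommGroup.mem_torsion]
      exact ((mem_strictSignedLocalPointsOfEmb_neg_one_zero_iff κ _ W Q).mp hQ).2

end LayerZero

/-! ## §4 Over `ℚ` with `E = ℚ_[p]`: the bound on cc-typer-6's `strictSelmerPInfty W p` -/

section Rat

variable (W : WeierstrassCurve ℚ) {p : ℕ} [Fact p.Prime] (κ : ZpExtension ℚ p)

/-- **`#Sel^{−,str}(W/ℚ_0) = #Sel_str(W/ℚ)[p^∞]`** — for `K = ℚ`, `E = ℚ_[p]` the right side of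
`natCard_strictSignedSelmerLayer_neg_one_zero_eq` is cc-typer-6's
`strictSelmerPInfty W p = W.selmerGroupPInfty p ⊓ selmerLocalKerPrimaryTorsion W ℚ_[p] p` (p259634 §2).
[cite: Kobayashi2003, §2 p. 4 (m = −1)] [cite: Skinner2020, §2.2] -/
theorem natCard_strictSignedSelmerLayer_neg_one_zero_eq_strictSelmerPInfty :
    Nat.card ↥(strictSignedSelmerLayer W κ ℚ_[p] (-1) 0) = Nat.card ↥(strictSelmerPInfty W p) :=
  natCard_strictSignedSelmerLayer_neg_one_zero_eq W ℚ_[p] κ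

end Rat

end StrictSignedLayerZero

namespace StrictSignedControlZero

variable (W : WeierstrassCurve ℚ) {p : ℕ} [Fact p.Prime] {κ : ZpExtension ℚ p}
  {γ : Field.absoluteGaloisGroup ℚ}

/-- **The strict-minus bottom-layer inequality in cc-typer-6's currency.** For `W/ℚ`, a
`ℤ_p`-extension `κ` of `ℚ` (the cyclotomic one in the application) with topological generator `γ`,
and a Pontryagin-dual datum `D` of the STRICT-MINUS Selmer group `Sel^{−,str}(W/ℚ_∞)` (Kobayashi's
odd condition with the `m = −1` clause, model `ℚ_[p]`) with `X` finitely generated torsion,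
`char(X) = (f)`, `f(0) ≠ 0`, NO non-trivial finite `Λ`-submodule, and `W(ℚ_∞)[p^∞] = 0`:
**`Sel_str(W/ℚ)[p^∞]` (`strictSelmerPInfty W p`) is finite and `ord_p #Sel_str(W/ℚ)[p^∞] ≤ ord_p f(0)`**
(FILE 2b's layer-0 bound transported by `natCard_strictSignedSelmerLayer_neg_one_zero_eq_strictSelmerPInfty`).
With `f ∣ X⁻¹L_p⁻(V, η, X)` (Kobayashi Thm. 4.1, odd `η`, `n = 0`, READ on `D`) this is the
inequality of `QuadraticBranchOddStrictSelmerBoundAt W p`. Nothing booked; O7-ss stays OPEN.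
[cite: Kobayashi2003, Lemma 9.1 (p. 25), §2 p. 4, Thm. 4.1 (p. 8)] [cite: GreenbergLNM1716, §4 Lemma 4.2 (p. 102)] -/
theorem finite_and_padicValNat_card_strictSelmerPInfty_le (hγ : κ.IsTopGenerator γ)
    (D : StrictSignedSelmerDualData W κ ℚ_[p] γ (-1))
    [Module.Finite (IwasawaAlgebra p) D.X] (hX : Module.IsTorsion (IwasawaAlgebra p) D.X)
    (hB : FixedPoints.addSubgroup κ.kerSubgroup (W.geomPrimaryTorsion p) = ⊥)
    (hnf : ∀ N : Submodule (IwasawaAlgebra p) D.X, Finite N → N = ⊥)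
    {f : IwasawaAlgebra p} (hf : D.charIdeal = Ideal.span {f})
    (h0 : PowerSeries.constantCoeff f ≠ 0) :
    Finite ↥(strictSelmerPInfty W p) ∧
      (padicValNat p (Nat.card ↥(strictSelmerPInfty W p)) : ℤ) ≤
        ((PowerSeries.constantCoeff f : ℤ_[p]) : ℚ_[p]).valuation := by
  obtain ⟨hfin, hle⟩ := finite_and_padicValNat_card_layer_zero_le hγ D hX hB hnf hf h0
  have hcard := StrictSignedLayerZero.natCard_strictSignedSelmerLayer_neg_one_zero_eq_strictSelmerPInfty W κ
  haveI := hfin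
  have hpos : 0 < Nat.card ↥(strictSignedSelmerLayer W κ ℚ_[p] (-1) 0) := Nat.card_pos
  refine ⟨Nat.finite_of_card_ne_zero (by rw [← hcard]; exact hpos.ne'), ?_⟩
  rw [← hcard]
  exact hle

end StrictSignedControlZero

end Summit.BirchSwinnertonDyer.Rank1Residual.Additive

end
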